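import Summits.ValiantsHypothesis.ValiantsHypothesis.Theorems.GrenetZeonDualUnipotentThreeHalvesHeavyTopIotaFourGraded

/-!
# `GrenetZeon.DualUnipotentThreeHalves` (stmt-ValiantsHypothesis-24318), R2 `HeavyTopLaw` — towards ι(4) = 3 in the kernel:
# the WEIGHTED graded-limit lemma and the generic-type-(3,1) case (cell «val-heavytop-census», engine seat val-htc-eng-1)

Companion of `…HeavyTopIotaFourGraded` (graded-limit lemma for the standard torus) and `…HeavyTopIotaFourTypeFour`
(`typeFour_row_or_col`).  Here:

* §1 `pow_eq_zero_of_initialForms_w`, `wforms2` — the graded-limit lemma for an ARBITRARY integer weight vector `w`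
  (height of `(a,b)` is `w b − w a`, torus `diag(t^{−w a})`); same proof as the unweighted one.
* §2 **`typeThreeOne_col`** — generic type `(3,1)` (NOTE-iota4 §3 with the lead's strengthening): if `V ≤ M₄(ℂ)` has `A³ = 0`
  for all members, contains `A = E₀₁ + E₁₂` (`= J₃ ⊕ 0`), lies in
  `T(A) = {B : B₂₀ = B₃₀ = B₂₃ = B₃₃ = 0, B₂₁ = −B₁₀, B₀₀+B₁₁+B₂₂ = 0}` (port-3's (T1) output for `p = 3`), and `dim V ≥ 4`, then
  every member has zero column `0` (common kernel line `ℂe₀`).  Weights `w = (0,1,2,1)`.  If some member `B₀` has `(B₀)₁₀ = 1`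
  (initial form `R = E₁₀ − E₂₁` at height `−1`) then (H0) a member `X` with `X₁₀ = 0` has zero diagonal and `X₁₃X₃₁ = 0`
  (its height-`0` form cubes to zero), (H3) a member with zero height-`≤ 0` part has height-`1` part proportional to `A`
  (`(R + X₁)³` has entries `a − b`, `−c`, `−d`), (H2) a member supported on `(0,2)` vanishes (`(R + eE₀₂)³₀₀ = −e`); hence the
  linear map `X ↦ (X₁₀, X₁₃ + X₃₁, X₀₁)` is injective on `V` and `dim V ≤ 3` — contradiction; so `X₁₀ ≡ 0`, the first column of
  every member is `X₀₀ e₀`, and `X₀₀ = 0` since `(X³)₀₀ = X₀₀³`.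

Honest framing: with (T1) (port-3 g2) and `typeFour_row_or_col` this gives «every nilpotent subspace of `M₄(ℂ)` of dimension `≥ 4`
is reducible» (ι(4) = 3) once assembled; nothing here proves or refutes `HeavyTopLaw`, 24318, S3b or 8062; `VP ≠ VNP` is not moved.
No definitions, no named facts. [NOTE-iota4 §3 (this seat); REPLICATION-iota4 (val-htc-lead) for the strengthening]
-/

noncomputable section

-- single-conjunct layout: Sub = Summit, duplicated namespace component intended
set_option linter.dupNamespace false
set_option linter.unnecessarySeqFocus false

namespace Summit.ValiantsHypothesis.ValiantsHypothesis.Theorems.GrenetZeon.HeavyTopIotaFour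

open Matrix Polynomial

/-! ## §1 The weighted graded-limit lemma -/

/-- Weighted torus: `diag(t^{-w a}) · diag(t^{w a}) = 1`. -/
theorem wtorus_mul {n : ℕ} (w : Fin n → ℤ) (t : ℂ) (ht : t ≠ 0) :
    (diagonal fun a : Fin n => t ^ (w a)) * (diagonal fun a : Fin n => t ^ (-(w a))) = 1 := by
  rw [diagonal_mul_diagonal, ← diagonal_one]
  congr 1; funext a
  rw [← zpow_add₀ ht]; simp

/-- **Weighted graded-limit lemma.**  As `pow_eq_zero_of_initialForms`, for the torus `diag(t^{-w a})`: heights are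
`w b − w a`. [NOTE-iota4 (T2); this file] -/
theorem pow_eq_zero_of_initialForms_w {n p k : ℕ} (hp : 1 ≤ p) (w : Fin n → ℤ)
    (V : Submodule ℂ (Matrix (Fin n) (Fin n) ℂ))
    (hV : ∀ A ∈ V, A ^ p = 0) (B : Fin k → Matrix (Fin n) (Fin n) ℂ) (hB : ∀ i, B i ∈ V)
    (h : Fin k → ℤ) (hlow : ∀ i (a b : Fin n), w b - w a < h i → B i a b = 0) (c : Fin k → ℂ) :
    (∑ i, c i • Matrix.of (fun a b : Fin n => if w b - w a = h i then B i a b else 0)) ^ p = 0 := by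
  classical
  let P : Matrix (Fin n) (Fin n) ℂ[X] :=
    Matrix.of fun a b => ∑ i, Polynomial.C (c i * B i a b) * X ^ (w b - w a - h i).toNat
  have heval : ∀ t : ℂ, t ≠ 0 →
      P.map (Polynomial.eval t) =
        (diagonal fun a : Fin n => t ^ (-(w a))) * (∑ i, (c i * t ^ (-(h i))) • B i) *
          (diagonal fun a : Fin n => t ^ (w a)) := by
    intro t ht
    ext a b
    simp only [P, map_apply, of_apply, Polynomial.eval_finsetSum, Polynomial.eval_mul, Polynomial.eval_C,
      Polynomial.eval_pow, Polynomial.eval_X, diagonal_mul, mul_diagonal, Matrix.sum_apply,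
      Matrix.smul_apply, smul_eq_mul, Finset.mul_sum, Finset.sum_mul]
    refine Finset.sum_congr rfl fun i _ => ?_
    by_cases hz : B i a b = 0
    · simp [hz]
    · have hge : h i ≤ w b - w a := by
        by_contra hlt; exact hz (hlow i a b (lt_of_not_ge hlt))
      have hnn : 0 ≤ w b - w a - h i := by linarith
      have key : t ^ (w b - w a - h i).toNat = t ^ (-(w a)) * t ^ (-(h i)) * t ^ (w b) := by
        rw [← zpow_natCast, Int.toNat_of_nonneg hnn, ← zpow_add₀ ht, ← zpow_add₀ ht]
        congr 1; ring
      rw [key]; ring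
  have hmem : ∀ t : ℂ, (∑ i, (c i * t ^ (-(h i))) • B i) ∈ V := by
    intro t
    exact V.sum_mem fun i _ => V.smul_mem _ (hB i)
  have hPt : ∀ t : ℂ, t ≠ 0 → (P ^ p).map (Polynomial.eval t) = 0 := by
    intro t ht
    have hm : (P ^ p).map (Polynomial.eval t) = (P.map (Polynomial.eval t)) ^ p := by
      change (Polynomial.evalRingHom t).mapMatrix (P ^ p) = ((Polynomial.evalRingHom t).mapMatrix P) ^ p
      exact map_pow _ _ _
    rw [hm, heval t ht]
    rcases conj_pow (diagonal fun a : Fin n => t ^ (-(w a))) (diagonal fun a : Fin n => t ^ (w a))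
        (∑ i, (c i * t ^ (-(h i))) • B i) (wtorus_mul w t ht) p with hc | hc
    · rw [hc, hV _ (hmem t)]; simp
    · omega
  have hPp : P ^ p = 0 := by
    refine Matrix.ext fun a b => ?_
    have hroots : ∀ t : ℂ, t ≠ 0 → ((P ^ p) a b).IsRoot t := by
      intro t ht
      have := congr_fun (congr_fun (hPt t ht) a) b
      simp only [Polynomial.IsRoot]; simpa using this
    apply Polynomial.eq_zero_of_infinite_isRoot
    apply Set.Infinite.mono (s := {t : ℂ | t ≠ 0})
    · intro t ht; exact hroots t ht
    · exact Set.infinite_of_finite_compl (by simp)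
  have h0 : (P.map (Polynomial.eval 0)) ^ p = 0 := by
    have hm : (P ^ p).map (Polynomial.eval 0) = (P.map (Polynomial.eval 0)) ^ p := by
      change (Polynomial.evalRingHom 0).mapMatrix (P ^ p) = ((Polynomial.evalRingHom 0).mapMatrix P) ^ p
      exact map_pow _ _ _
    rw [← hm, hPp]; simp
  have hP0 : P.map (Polynomial.eval 0) =
      ∑ i, c i • Matrix.of (fun a b : Fin n => if w b - w a = h i then B i a b else 0) := by
    ext a b
    simp only [P, map_apply, of_apply, Polynomial.eval_finsetSum, Polynomial.eval_mul, Polynomial.eval_C,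
      Polynomial.eval_pow, Polynomial.eval_X, Matrix.sum_apply, Matrix.smul_apply, smul_eq_mul]
    refine Finset.sum_congr rfl fun i _ => ?_
    by_cases heq : w b - w a = h i
    · simp [heq]
    · by_cases hz : B i a b = 0
      · simp [hz]
      · have hge : h i ≤ w b - w a := by
          by_contra hlt; exact hz (hlow i a b (lt_of_not_ge hlt))
        have hpos : 0 < (w b - w a - h i).toNat := by
          have : 0 < w b - w a - h i := by omega
          omega
        simp [heq, zero_pow hpos.ne']
  rw [← hP0]; exact h0

/-- Weighted graded-limit lemma, two forms. -/
theorem wforms2 {n p : ℕ} (hp : 1 ≤ p) (w : Fin n → ℤ) (V : Submodule ℂ (Matrix (Fin n) (Fin n) ℂ))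
    (hV : ∀ A ∈ V, A ^ p = 0)
    (B₁ B₂ : Matrix (Fin n) (Fin n) ℂ) (hB₁ : B₁ ∈ V) (hB₂ : B₂ ∈ V) (h₁ h₂ : ℤ)
    (hl₁ : ∀ a b : Fin n, w b - w a < h₁ → B₁ a b = 0) (hl₂ : ∀ a b : Fin n, w b - w a < h₂ → B₂ a b = 0)
    (c₁ c₂ : ℂ) :
    (c₁ • Matrix.of (fun a b : Fin n => if w b - w a = h₁ then B₁ a b else 0) +
      c₂ • Matrix.of (fun a b : Fin n => if w b - w a = h₂ then B₂ a b else 0)) ^ p = 0 := by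
  have key := pow_eq_zero_of_initialForms_w hp w V hV ![B₁, B₂]
    (by intro i; fin_cases i <;> simp [hB₁, hB₂]) ![h₁, h₂]
    (by intro i; fin_cases i <;> simp <;> assumption) ![c₁, c₂]
  simpa only [Fin.sum_univ_succ, Fin.sum_univ_zero, Matrix.cons_val_zero, Matrix.cons_val_succ, add_zero] using key

/-! ## §2 Generic type `(3,1)`: the graded limit of a nilpotent `V ∋ J₃ ⊕ 0` of dimension `≥ 4` -/

section TypeThreeOne

variable (V : Submodule ℂ (Matrix (Fin 4) (Fin 4) ℂ))

/-- (H0) A member with `X₁₀ = 0` (no height `−1` part for `w = (0,1,2,1)`) has zero diagonal and `X₁₃X₃₁ = 0`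
(its height-`0` initial form `diag ⊕ [[d₁, x],[y, 0]]` has cube zero). -/
theorem typeThreeOne_H0 (hV : ∀ A ∈ V, A ^ 3 = 0)
    (hT : ∀ B ∈ V, B 2 0 = 0 ∧ B 3 0 = 0 ∧ B 2 3 = 0 ∧ B 3 3 = 0 ∧ B 2 1 = -B 1 0 ∧ B 0 0 + B 1 1 + B 2 2 = 0)
    {X : Matrix (Fin 4) (Fin 4) ℂ} (hX : X ∈ V) (hX10 : X 1 0 = 0) :
    X 0 0 = 0 ∧ X 1 1 = 0 ∧ X 2 2 = 0 ∧ X 1 3 * X 3 1 = 0 := by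
  obtain ⟨h20, h30, h23, h33, h21, -⟩ := hT X hX
  rw [hX10, neg_zero] at h21
  have k0 := wforms2 (n := 4) (p := 3) (by norm_num) ![0, 1, 2, 1] V hV X X hX hX 0 0
    (by intro a b hab; fin_cases a <;> fin_cases b <;> simp at hab ⊢ <;> assumption)
    (by intro a b hab; fin_cases a <;> fin_cases b <;> simp at hab ⊢ <;> assumption) 1 0
  have hM : ((1 : ℂ) • Matrix.of (fun a b : Fin 4 => if (![0, 1, 2, 1] : Fin 4 → ℤ) b - (![0, 1, 2, 1] : Fin 4 → ℤ) a = 0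
        then X a b else 0) +
      (0 : ℂ) • Matrix.of (fun a b : Fin 4 => if (![0, 1, 2, 1] : Fin 4 → ℤ) b - (![0, 1, 2, 1] : Fin 4 → ℤ) a = 0
        then X a b else 0)) =
      !![X 0 0, 0, 0, 0; 0, X 1 1, 0, X 1 3; 0, 0, X 2 2, 0; 0, X 3 1, 0, 0] := by
    ext a b; fin_cases a <;> fin_cases b <;> simp [h33]
  rw [hM] at k0
  have hsq : (!![X 0 0, 0, 0, 0; 0, X 1 1, 0, X 1 3; 0, 0, X 2 2, 0; 0, X 3 1, 0, 0] : Matrix (Fin 4) (Fin 4) ℂ) *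
      !![X 0 0, 0, 0, 0; 0, X 1 1, 0, X 1 3; 0, 0, X 2 2, 0; 0, X 3 1, 0, 0] =
      !![X 0 0 ^ 2, 0, 0, 0; 0, X 1 1 ^ 2 + X 1 3 * X 3 1, 0, X 1 1 * X 1 3; 0, 0, X 2 2 ^ 2, 0;
         0, X 3 1 * X 1 1, 0, X 3 1 * X 1 3] := by
    ext i j; fin_cases i <;> fin_cases j <;> simp [Matrix.mul_apply, Fin.sum_univ_four] <;> ring
  rw [pow_succ, pow_two, hsq] at k0
  have e00 := congr_fun (congr_fun k0 0) 0
  have e22 := congr_fun (congr_fun k0 2) 2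
  have e11 := congr_fun (congr_fun k0 1) 1
  have e33 := congr_fun (congr_fun k0 3) 3
  have e13 := congr_fun (congr_fun k0 1) 3
  simp [Matrix.mul_apply, Fin.sum_univ_four] at e00 e22 e11 e33 e13
  have d1 : X 1 1 = 0 := by
    rcases e33 with (h | h) | h
    · have : X 1 1 ^ 3 = 0 := by rw [h] at e11; linear_combination e11
      exact pow_eq_zero_iff (n := 3) (by norm_num) |>.mp this
    · exact h
    · have : X 1 1 ^ 3 = 0 := by rw [h] at e11; linear_combination e11
      exact pow_eq_zero_iff (n := 3) (by norm_num) |>.mp this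
  refine ⟨e00, d1, e22, ?_⟩
  rw [d1] at e13
  rcases e13 with h | h
  · linear_combination h
  · rw [h, zero_mul]

/-- (H2) With `B₀ ∈ V`, `(B₀)₁₀ = 1`: a member supported on the corner `(0,2)` vanishes (`((E₁₀−E₂₁) + eE₀₂)³₀₀ = −e`). -/
theorem typeThreeOne_H2 (hV : ∀ A ∈ V, A ^ 3 = 0)
    (hT : ∀ B ∈ V, B 2 0 = 0 ∧ B 3 0 = 0 ∧ B 2 3 = 0 ∧ B 3 3 = 0 ∧ B 2 1 = -B 1 0 ∧ B 0 0 + B 1 1 + B 2 2 = 0)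
    {B₀ : Matrix (Fin 4) (Fin 4) ℂ} (hB₀ : B₀ ∈ V) (h10 : B₀ 1 0 = 1)
    {X : Matrix (Fin 4) (Fin 4) ℂ} (hX : X ∈ V) (hX10 : X 1 0 = 0) (hX00 : X 0 0 = 0) (hX11 : X 1 1 = 0) (hX22 : X 2 2 = 0)
    (hX13 : X 1 3 = 0) (hX31 : X 3 1 = 0) (hX01 : X 0 1 = 0) (hX12 : X 1 2 = 0) (hX03 : X 0 3 = 0) (hX32 : X 3 2 = 0) :
    X 0 2 = 0 := by
  obtain ⟨h20, h30, h23, h33, h21, -⟩ := hT X hX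
  rw [hX10, neg_zero] at h21
  obtain ⟨b20, b30, b23, b33, b21, -⟩ := hT B₀ hB₀
  rw [h10] at b21
  have k0 := wforms2 (n := 4) (p := 3) (by norm_num) ![0, 1, 2, 1] V hV B₀ X hB₀ hX (-1) 2
    (by intro a b hab; fin_cases a <;> fin_cases b <;> simp at hab ⊢ <;> assumption)
    (by intro a b hab; fin_cases a <;> fin_cases b <;> simp at hab ⊢ <;> assumption) 1 1
  have hM : ((1 : ℂ) • Matrix.of (fun a b : Fin 4 => if (![0, 1, 2, 1] : Fin 4 → ℤ) b - (![0, 1, 2, 1] : Fin 4 → ℤ) a = -1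
        then B₀ a b else 0) +
      (1 : ℂ) • Matrix.of (fun a b : Fin 4 => if (![0, 1, 2, 1] : Fin 4 → ℤ) b - (![0, 1, 2, 1] : Fin 4 → ℤ) a = 2
        then X a b else 0)) =
      !![0, 0, X 0 2, 0; 1, 0, 0, 0; 0, -1, 0, 0; 0, 0, 0, 0] := by
    ext a b; fin_cases a <;> fin_cases b <;> simp [h10, b21, b30, b23]
  rw [hM] at k0
  have hsq : (!![0, 0, X 0 2, 0; 1, 0, 0, 0; 0, -1, 0, 0; 0, 0, 0, 0] : Matrix (Fin 4) (Fin 4) ℂ) *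
      !![0, 0, X 0 2, 0; 1, 0, 0, 0; 0, -1, 0, 0; 0, 0, 0, 0] =
      !![0, -(X 0 2), 0, 0; 0, 0, X 0 2, 0; -1, 0, 0, 0; 0, 0, 0, 0] := by
    ext i j; fin_cases i <;> fin_cases j <;> simp [Matrix.mul_apply, Fin.sum_univ_four]
  rw [pow_succ, pow_two, hsq] at k0
  have e := congr_fun (congr_fun k0 0) 0
  simp [Matrix.mul_apply, Fin.sum_univ_four] at e
  exact e

/-- (H3) With `B₀ ∈ V`, `(B₀)₁₀ = 1`: a member with zero height-`≤ 0` part has height-`1` part proportional to `A` and no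
`(0,3)`, `(3,2)` entries (`((E₁₀−E₂₁) + X₁)³` has entries `X₀₁ − X₁₂`, `−X₀₃`, `−X₃₂`). [lead's strengthening of NOTE-iota4 §3] -/
theorem typeThreeOne_H3 (hV : ∀ A ∈ V, A ^ 3 = 0)
    (hT : ∀ B ∈ V, B 2 0 = 0 ∧ B 3 0 = 0 ∧ B 2 3 = 0 ∧ B 3 3 = 0 ∧ B 2 1 = -B 1 0 ∧ B 0 0 + B 1 1 + B 2 2 = 0)
    {B₀ : Matrix (Fin 4) (Fin 4) ℂ} (hB₀ : B₀ ∈ V) (h10 : B₀ 1 0 = 1)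
    {X : Matrix (Fin 4) (Fin 4) ℂ} (hX : X ∈ V) (hX10 : X 1 0 = 0) (hX00 : X 0 0 = 0) (hX11 : X 1 1 = 0) (hX22 : X 2 2 = 0)
    (hX13 : X 1 3 = 0) (hX31 : X 3 1 = 0) :
    X 1 2 = X 0 1 ∧ X 0 3 = 0 ∧ X 3 2 = 0 := by
  obtain ⟨h20, h30, h23, h33, h21, -⟩ := hT X hX
  rw [hX10, neg_zero] at h21
  obtain ⟨b20, b30, b23, b33, b21, -⟩ := hT B₀ hB₀
  rw [h10] at b21
  have k0 := wforms2 (n := 4) (p := 3) (by norm_num) ![0, 1, 2, 1] V hV B₀ X hB₀ hX (-1) 1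
    (by intro a b hab; fin_cases a <;> fin_cases b <;> simp at hab ⊢ <;> assumption)
    (by intro a b hab; fin_cases a <;> fin_cases b <;> simp at hab ⊢ <;> assumption) 1 1
  have hM : ((1 : ℂ) • Matrix.of (fun a b : Fin 4 => if (![0, 1, 2, 1] : Fin 4 → ℤ) b - (![0, 1, 2, 1] : Fin 4 → ℤ) a = -1
        then B₀ a b else 0) +
      (1 : ℂ) • Matrix.of (fun a b : Fin 4 => if (![0, 1, 2, 1] : Fin 4 → ℤ) b - (![0, 1, 2, 1] : Fin 4 → ℤ) a = 1
        then X a b else 0)) =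
      !![0, X 0 1, 0, X 0 3; 1, 0, X 1 2, 0; 0, -1, 0, 0; 0, 0, X 3 2, 0] := by
    ext a b; fin_cases a <;> fin_cases b <;> simp [h10, b21, b30, b23]
  rw [hM] at k0
  have hsq : (!![0, X 0 1, 0, X 0 3; 1, 0, X 1 2, 0; 0, -1, 0, 0; 0, 0, X 3 2, 0] : Matrix (Fin 4) (Fin 4) ℂ) *
      !![0, X 0 1, 0, X 0 3; 1, 0, X 1 2, 0; 0, -1, 0, 0; 0, 0, X 3 2, 0] =
      !![X 0 1, 0, X 0 1 * X 1 2 + X 0 3 * X 3 2, 0; 0, X 0 1 - X 1 2, 0, X 0 3; -1, 0, -(X 1 2), 0;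
         0, -(X 3 2), 0, 0] := by
    ext i j; fin_cases i <;> fin_cases j <;> simp [Matrix.mul_apply, Fin.sum_univ_four] <;> ring
  rw [pow_succ, pow_two, hsq] at k0
  have e10 := congr_fun (congr_fun k0 1) 0
  have e23 := congr_fun (congr_fun k0 2) 3
  have e30 := congr_fun (congr_fun k0 3) 0
  simp [Matrix.mul_apply, Fin.sum_univ_four] at e10 e23 e30
  exact ⟨by linear_combination -e10, e23, e30⟩

/-- **Type (3,1), second half of ι(4) = 3** (NOTE-iota4 §3): if `V ≤ M₄(ℂ)` has `A³ = 0` for all members, lies in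
`T(E₀₁+E₁₂)` (membership of `E₀₁+E₁₂` itself is not even needed) and `dim V ≥ 4`, then every member has zero first column (common kernel line `ℂe₀`).
[NOTE-iota4 §3; this file] -/
theorem typeThreeOne_col (hV : ∀ A ∈ V, A ^ 3 = 0)
    (hT : ∀ B ∈ V, B 2 0 = 0 ∧ B 3 0 = 0 ∧ B 2 3 = 0 ∧ B 3 3 = 0 ∧ B 2 1 = -B 1 0 ∧ B 0 0 + B 1 1 + B 2 2 = 0)
    (hdim : 4 ≤ Module.finrank ℂ V) :
    ∀ B ∈ V, ∀ i : Fin 4, B i 0 = 0 := by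
  classical
  -- Step 1: every member has X₁₀ = 0
  have h10 : ∀ X ∈ V, X 1 0 = 0 := by
    by_contra hcon
    push Not at hcon
    obtain ⟨B, hB, hB10⟩ := hcon
    set B₀ : Matrix (Fin 4) (Fin 4) ℂ := (B 1 0)⁻¹ • B with hB₀def
    have hB₀ : B₀ ∈ V := V.smul_mem _ hB
    have hb10 : B₀ 1 0 = 1 := by simp [hB₀def, inv_mul_cancel₀ hB10]
    -- the injective map X ↦ (X₁₀, X₁₃ + X₃₁, X₀₁)
    let Ψ : Matrix (Fin 4) (Fin 4) ℂ →ₗ[ℂ] (Fin 3 → ℂ) :=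
      { toFun := fun X => ![X 1 0, X 1 3 + X 3 1, X 0 1]
        map_add' := by intro X Y; ext i; fin_cases i <;> simp <;> ring
        map_smul' := by intro c X; ext i; fin_cases i <;> simp <;> ring }
    have hΨ : ∀ X ∈ V, Ψ X = 0 → X = 0 := by
      intro X hX hΨX
      have e0 := congr_fun hΨX 0
      have e1 := congr_fun hΨX 1
      have e2 := congr_fun hΨX 2
      simp [Ψ] at e0 e1 e2
      obtain ⟨h20, h30, h23, h33, h21, -⟩ := hT X hX
      have hX10 : X 1 0 = 0 := e0
      rw [hX10, neg_zero] at h21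
      obtain ⟨hX00, hX11, hX22, hprod⟩ := typeThreeOne_H0 V hV hT hX hX10
      have hX13 : X 1 3 = 0 := by
        have : X 1 3 ^ 2 = 0 := by
          have h31 : X 3 1 = -X 1 3 := by linear_combination e1
          rw [h31] at hprod; linear_combination -hprod
        exact pow_eq_zero_iff (n := 2) (by norm_num) |>.mp this
      have hX31 : X 3 1 = 0 := by linear_combination e1 - hX13
      obtain ⟨hX12, hX03, hX32⟩ := typeThreeOne_H3 V hV hT hB₀ hb10 hX hX10 hX00 hX11 hX22 hX13 hX31
      have hX01 : X 0 1 = 0 := e2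
      rw [hX01] at hX12
      have hX02 := typeThreeOne_H2 V hV hT hB₀ hb10 hX hX10 hX00 hX11 hX22 hX13 hX31 hX01 hX12 hX03 hX32
      ext i j; fin_cases i <;> fin_cases j <;> simp <;> assumption
    have hinj : Function.Injective (Ψ.domRestrict V) := by
      intro x y hxy
      apply Subtype.ext
      have h0 : Ψ (x.1 - y.1) = 0 := by
        rw [map_sub]; exact sub_eq_zero.mpr (by simpa using hxy)
      exact sub_eq_zero.mp (hΨ (x.1 - y.1) (V.sub_mem x.2 y.2) h0)
    have hle := LinearMap.finrank_le_finrank_of_injective hinj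
    simp only [Module.finrank_fin_fun] at hle
    omega
  -- Step 2: the first column of every member is X₀₀ e₀, and X₀₀ is an eigenvalue of a nilpotent
  intro X hX i
  obtain ⟨h20, h30, -, -, h21, -⟩ := hT X hX
  have hX10 := h10 X hX
  have h00 : X 0 0 = 0 := by
    have e : (X ^ 3) 0 0 = X 0 0 ^ 3 := by
      simp [pow_succ, Matrix.mul_apply, Fin.sum_univ_four, hX10, h20, h30]
    rw [hV X hX] at e
    exact (pow_eq_zero_iff (n := 3) (by norm_num)).mp (by simpa using e.symm)
  fin_cases i
  · exact h00
  · exact hX10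
  · exact h20
  · exact h30

end TypeThreeOne

end Summit.ValiantsHypothesis.ValiantsHypothesis.Theorems.GrenetZeon.HeavyTopIotaFour

end
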